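import Mathlib
import HarnessLib
import Summits.ResolutionOfSingularities.ResolutionOfSingularities.Theses.EquisingularLift

/-!
# Birth skeleton (BC3) of the child `LiftableIsolation` of `EquisingularLift` (stmt-ResolutionOfSingularities-15660)

Line `birth` (crux-strategist BC2 redirect, 2026-08-17, rev b). `LiftableIsolation` = child 1/2 of the STRATA split of
`EquisingularLift`: for every integral hypersurface `H ⊆ ℙⁿ_k` (`k = k̄`, char `p`) there are a COMPLETE
characteristic-0 DVR `O` with algebraically closed residue field, a smooth proper `P → Spec O`, a closed `Y ⊆ P_s`
with `V(Y) ≅ H`, and a chain of blow-ups of `P` in REGULAR centres off the generic point of `Y` with IRREDUCIBLE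
special fibre (all centres horizontal = liftable) after which the reduced iterated strict transform has only
FINITELY MANY non-regular points, at each of which the AMBIENT has GOOD REDUCTION (`GoodAt`: ambient regular and the
uniformizer a regular parameter, i.e. the blown-up ambient is smooth over `O` there — the clause that keeps the second
child honest, see `Cruxes/EquisingularLift/STRATEGY-CENSUS.md` §N3: a coalesced pair of conjugate centres leaves an
`A₁` point of the special fibre that NO further horizontal blow-up removes, by the monodromy swap on `H²`).

The cut (two named stubs; `LiftableIsolation_of` PROVED, sorries only inside the stubs):
* `stub_ambientLift` (KNOWN, M-sized formalisation: Witt vectors): `O := W(k)` (complete DVR of characteristic 0 with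
  residue field `k`), `P := ℙⁿ_O` (smooth proper), `Y :=` the image of `H` in `P_s = ℙⁿ_k` (`V(Y) = Y_red ≅ H` as `H` is
  reduced), `P_s` irreducible.
* `stub_isolateInAmbient` (OPEN — the load-bearing stub): in ANY such nice ambient, liftable horizontal regular blow-ups
  off the generic point of `Y` leave only finitely many singular points of the strict transform, all at points of good
  reduction of the blown-up ambient ("resolve generically along every positive-dimensional singular stratum, by
  liftable centres, without parking the leftover points on damaged fibres").
-/

set_option linter.dupNamespace false

noncomputable section

open CategoryTheory AlgebraicGeometry TopologicalSpace Topology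
open Literature.AlgebraicGeometry.Resolution

namespace Summit.ResolutionOfSingularities.ResolutionOfSingularities.Cruxes.LiftableIsolation.Birth

/-- VERBATIM mirror of the child statement `EquisingularLift.LiftableIsolation` (rev b; not yet a route decl: the split
is filed with this skeleton; afterwards the conclusion is the route decl by `Iff.rfl`). -/
def LiftableIsolation : Prop :=
  ∀ p : ℕ, p.Prime → ∀ (k : Type) [Field k] [CharP k p] [IsAlgClosed k] (n : ℕ) (H : AlgebraicGeometry.Scheme.{0}) (ι : H ⟶ (Literature.AlgebraicGeometry.Motives.projectiveSpace n k).left), AlgebraicGeometry.IsClosedImmersion ι → AlgebraicGeometry.IsIntegral H → (∀ y : (Literature.AlgebraicGeometry.Motives.projectiveSpace n k).left, ∃ U : (Literature.AlgebraicGeometry.Motives.projectiveSpace n k).left.affineOpens, y ∈ (U : (Literature.AlgebraicGeometry.Motives.projectiveSpace n k).left.Opens) ∧ (ι.ker.ideal U).IsPrincipal) → ∃ (O : Type) (_ : CommRing O) (_ : IsDomain O) (_ : IsDiscreteValuationRing O) (_ : CharZero O) (_ : IsAdicComplete (IsLocalRing.maximalIdeal O) O) (_ : IsAlgClosed (IsLocalRing.ResidueField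 O)) (P P' : AlgebraicGeometry.Scheme.{0}) (q : P ⟶ AlgebraicGeometry.Spec (.of O)) (Y : TopologicalSpace.Closeds P) (σ : P' ⟶ P) (S' : Set P'), AlgebraicGeometry.Smooth q ∧ AlgebraicGeometry.IsProper q ∧ (Y : Set P) ⊆ q ⁻¹' {IsLocalRing.closedPoint O} ∧ Nonempty ((AlgebraicGeometry.Scheme.IdealSheafData.vanishingIdeal Y).subscheme ≅ H) ∧ (∀ Q : (∀ X' : AlgebraicGeometry.Scheme.{0}, (X' ⟶ P) → Set X' → Prop), Q P (CategoryTheory.CategoryStruct.id P) (Y : Set P) → (∀ (X' X'' : AlgebraicGeometry.Scheme.{0}) (σ' : X' ⟶ P) (Y' : Set X') (C : X'.IdealSheafData) (τ : X'' ⟶ X'), Q X' σ' Y' → Literature.AlgebraicGeometry.Resolution.IsBlowup τ C → Literature.AlgebraicGeometry.Resolution.Scheme.IsRegular C.subscheme → σ' '' (C.support : Set X') ⊆ {x : P | ¬ IsGenericPoint x (Y : Set P)} → Q X'' (CategoryTheory.CategoryStruct.comp τ σ') (closure (τ ⁻¹' (Y' \ (C.support : Set X'))))) → Q P' σ S') ∧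 IsIrreducible (((CategoryTheory.CategoryStruct.comp σ q)) ⁻¹' {IsLocalRing.closedPoint O}) ∧ Set.Finite {x : ↥(AlgebraicGeometry.Scheme.IdealSheafData.vanishingIdeal (⟨closure S', isClosed_closure⟩ : TopologicalSpace.Closeds P')).subscheme | ¬ IsRegularLocalRing ((AlgebraicGeometry.Scheme.IdealSheafData.vanishingIdeal (⟨closure S', isClosed_closure⟩ : TopologicalSpace.Closeds P')).subscheme.presheaf.stalk x)} ∧ (∀ x : ↥(AlgebraicGeometry.Scheme.IdealSheafData.vanishingIdeal (⟨closure S', isClosed_closure⟩ : TopologicalSpace.Closeds P')).subscheme, ¬ IsRegularLocalRing ((AlgebraicGeometry.Scheme.IdealSheafData.vanishingIdeal (⟨closure S', isClosed_closure⟩ : TopologicalSpace.Closeds P')).subscheme.presheaf.stalk x) → IsRegularLocalRing (P'.presheaf.stalk ((AlgebraicGeometry.Scheme.IdealSheafData.vanishingIdeal (⟨closure S', isClosed_closure⟩ : TopologicalSpace.Closeds P')).subschemeι x)) ∧ ∀ ϖ : O, Irreducible ϖ → (P'.presheaf.Γgerm ((AlgebraicGeometry.Scheme.IdealSheafData.vanishingIdeal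 (⟨closure S', isClosed_closure⟩ : TopologicalSpace.Closeds P')).subschemeι x)).hom (((CategoryTheory.CategoryStruct.comp σ q)).appTop.hom ((AlgebraicGeometry.Scheme.ΓSpecIso (CommRingCat.of O)).inv.hom ϖ)) ∉ (IsLocalRing.maximalIdeal (P'.presheaf.stalk ((AlgebraicGeometry.Scheme.IdealSheafData.vanishingIdeal (⟨closure S', isClosed_closure⟩ : TopologicalSpace.Closeds P')).subschemeι x))) ^ 2)

/-! ## Helper notions used only in the proofs (each unfolds, by `Iff.rfl`, to the inlined text above) -/

/-- The recursor-encoded chain of blow-ups in regular centres off the generic point(s) of `Y`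
(verbatim the fifth conjunct of `EquisingularLift`, abstracted in `P, Y, P', σ, S'`). -/
def Chain (P : Scheme.{0}) (Y : Set P) (P' : Scheme.{0}) (σ : P' ⟶ P) (S' : Set P') : Prop :=
  ∀ Q : (∀ X' : AlgebraicGeometry.Scheme.{0}, (X' ⟶ P) → Set X' → Prop),
    Q P (CategoryTheory.CategoryStruct.id P) Y →
    (∀ (X' X'' : AlgebraicGeometry.Scheme.{0}) (σ' : X' ⟶ P) (Y' : Set X') (C : X'.IdealSheafData)
      (τ : X'' ⟶ X'), Q X' σ' Y' → Literature.AlgebraicGeometry.Resolution.IsBlowup τ C →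
      Literature.AlgebraicGeometry.Resolution.Scheme.IsRegular C.subscheme →
      σ' '' (C.support : Set X') ⊆ {x : P | ¬ IsGenericPoint x Y} →
      Q X'' (CategoryTheory.CategoryStruct.comp τ σ') (closure (τ ⁻¹' (Y' \ (C.support : Set X'))))) →
    Q P' σ S'

/-- The non-regular locus of the reduced closed subscheme on `closure S'`. -/
def singSet {P' : Scheme.{0}} (S' : Set P') : Set ↥((Scheme.IdealSheafData.vanishingIdeal
    (⟨closure S', isClosed_closure⟩ : Closeds P')).subscheme) :=
  {x | ¬ IsRegularLocalRing (((Scheme.IdealSheafData.vanishingIdeal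
    (⟨closure S', isClosed_closure⟩ : Closeds P')).subscheme).presheaf.stalk x)}

/-- GOOD REDUCTION OF THE AMBIENT AT A POINT: the ambient `P'` (with structure morphism `r` to `Spec O`) is
regular at `y` and the uniformizer of `O` is a regular PARAMETER there (`ϖ ∉ 𝔪_y²`) — for the `O`-flat
finite-type stages of a chain this says exactly that `P' → Spec O` is smooth at `y` (regular special fibre at
`y`, residue field of `O` algebraically closed). -/
def GoodAt {O : Type} [CommRing O] {P' : Scheme.{0}} (r : P' ⟶ Spec (.of O)) (y : P') : Prop :=
  IsRegularLocalRing (P'.presheaf.stalk y) ∧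
    ∀ ϖ : O, Irreducible ϖ → (P'.presheaf.Γgerm y).hom (r.appTop.hom ((Scheme.ΓSpecIso (.of O)).inv.hom ϖ)) ∉
      (IsLocalRing.maximalIdeal (P'.presheaf.stalk y)) ^ 2

/-- The good-reduction clause of the split: the ambient has good reduction at every NON-REGULAR point of the
reduced strict transform `V(closure S')`. -/
def GoodSet {O : Type} [CommRing O] {P' : Scheme.{0}} (r : P' ⟶ Spec (.of O)) (S' : Set P') : Prop :=
  ∀ x : ↥((Scheme.IdealSheafData.vanishingIdeal (⟨closure S', isClosed_closure⟩ : Closeds P')).subscheme),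
    ¬ IsRegularLocalRing (((Scheme.IdealSheafData.vanishingIdeal
      (⟨closure S', isClosed_closure⟩ : Closeds P')).subscheme).presheaf.stalk x) →
    GoodAt r ((Scheme.IdealSheafData.vanishingIdeal (⟨closure S', isClosed_closure⟩ : Closeds P')).subschemeι x)


/-! ## The stubs -/

/-- **STUB `stub_ambientLift` (known; Witt vectors).** For every integral hypersurface `H ⊆ ℙⁿ_k` over an
algebraically closed field `k` of characteristic `p` there are a complete DVR `O` of characteristic `0` with
algebraically closed residue field, a smooth proper `q : P → Spec O` with IRREDUCIBLE special fibre and a closed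
`Y ⊆ P_s` whose reduced induced subscheme is isomorphic to `H` (`O = W(k)`, `P = ℙⁿ_{W(k)}`, `Y = H ⊆ ℙⁿ_k = P_s`).
[cite: Serre1979, II §5–6 (Witt vectors); Hartshorne1977, II.4.9 and III.10.1 (ℙⁿ proper, smooth)] -/
theorem stub_ambientLift : ∀ p : ℕ, p.Prime → ∀ (k : Type) [Field k] [CharP k p] [IsAlgClosed k] (n : ℕ) (H : AlgebraicGeometry.Scheme.{0}) (ι : H ⟶ (Literature.AlgebraicGeometry.Motives.projectiveSpace n k).left), AlgebraicGeometry.IsClosedImmersion ι → AlgebraicGeometry.IsIntegral H → (∀ y : (Literature.AlgebraicGeometry.Motives.projectiveSpace n k).left, ∃ U : (Literature.AlgebraicGeometry.Motives.projectiveSpace n k).left.affineOpens, y ∈ (U : (Literature.AlgebraicGeometry.Motives.projectiveSpace n k).left.Opens) ∧ (ι.ker.ideal U).IsPrincipal) → ∃ (O : Type) (_ : CommRing O) (_ : IsDomain O) (_ : IsDiscreteValuationRing O) (_ : CharZero O) (_ : IsAdicComplete (IsLocalRing.maximalIdeal O) O) (_ : IsAlgClosed (IsLocalRing.ResidueField O))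 (P : AlgebraicGeometry.Scheme.{0}) (q : P ⟶ AlgebraicGeometry.Spec (.of O)) (Y : TopologicalSpace.Closeds P), AlgebraicGeometry.Smooth q ∧ AlgebraicGeometry.IsProper q ∧ (Y : Set P) ⊆ q ⁻¹' {IsLocalRing.closedPoint O} ∧ Nonempty ((AlgebraicGeometry.Scheme.IdealSheafData.vanishingIdeal Y).subscheme ≅ H) ∧ IsIrreducible (q ⁻¹' {IsLocalRing.closedPoint O}) := by
  sorry

/-- **STUB `stub_isolateInAmbient` (OPEN; load-bearing).** In any such ambient: a chain of blow-ups in regular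
centres off the generic point of `Y`, all horizontal (irreducible special fibre), leaves only FINITELY MANY non-regular
points on the reduced iterated strict transform, and the blown-up ambient has good reduction (`GoodAt`) at each of
them. [cite: Ishii2025, Thm 1.1/Cor 1.5; CossartJannsenSaito2020; Bennett1970; Kollar2007, §3.13] -/
theorem stub_isolateInAmbient : ∀ p : ℕ, p.Prime → ∀ (k : Type) [Field k] [CharP k p] [IsAlgClosed k] (n : ℕ) (H : AlgebraicGeometry.Scheme.{0}) (ι : H ⟶ (Literature.AlgebraicGeometry.Motives.projectiveSpace n k).left), AlgebraicGeometry.IsClosedImmersion ι → AlgebraicGeometry.IsIntegral H → (∀ y : (Literature.AlgebraicGeometry.Motives.projectiveSpace n k).left, ∃ U : (Literature.AlgebraicGeometry.Motives.projectiveSpace n k).left.affineOpens, y ∈ (U : (Literature.AlgebraicGeometry.Motives.projectiveSpace n k).left.Opens) ∧ (ι.ker.ideal U).IsPrincipal) → ∀ (O : Type) [CommRing O] [IsDomain O] [IsDiscreteValuationRing O] [CharZero O] [IsAdicComplete (IsLocalRing.maximalIdeal O) O] [IsAlgClosed (IsLocalRing.ResidueField O)] (P : AlgebraicGeometry.Scheme.{0})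 (q : P ⟶ AlgebraicGeometry.Spec (.of O)) (Y : TopologicalSpace.Closeds P), AlgebraicGeometry.Smooth q → AlgebraicGeometry.IsProper q → (Y : Set P) ⊆ q ⁻¹' {IsLocalRing.closedPoint O} → Nonempty ((AlgebraicGeometry.Scheme.IdealSheafData.vanishingIdeal Y).subscheme ≅ H) → IsIrreducible (q ⁻¹' {IsLocalRing.closedPoint O}) → ∃ (P' : AlgebraicGeometry.Scheme.{0}) (σ : P' ⟶ P) (S' : Set P'), Chain P (Y : Set P) P' σ S' ∧ IsIrreducible (((CategoryTheory.CategoryStruct.comp σ q)) ⁻¹' {IsLocalRing.closedPoint O}) ∧ (singSet S').Finite ∧ GoodSet ((CategoryTheory.CategoryStruct.comp σ q)) S' := by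
  sorry

/-! ## The composition (kernel-checked; no `sorry` in its own term) -/

/-- **`LiftableIsolation` from the two stub statements** (lift the ambient, then isolate inside it). -/
theorem LiftableIsolation_of :
    (∀ p : ℕ, p.Prime → ∀ (k : Type) [Field k] [CharP k p] [IsAlgClosed k] (n : ℕ) (H : AlgebraicGeometry.Scheme.{0}) (ι : H ⟶ (Literature.AlgebraicGeometry.Motives.projectiveSpace n k).left), AlgebraicGeometry.IsClosedImmersion ι → AlgebraicGeometry.IsIntegral H → (∀ y : (Literature.AlgebraicGeometry.Motives.projectiveSpace n k).left, ∃ U : (Literature.AlgebraicGeometry.Motives.projectiveSpace n k).left.affineOpens, y ∈ (U : (Literature.AlgebraicGeometry.Motives.projectiveSpace n k).left.Opens) ∧ (ι.ker.ideal U).IsPrincipal) → ∃ (O : Type) (_ : CommRing O) (_ : IsDomain O) (_ : IsDiscreteValuationRing O) (_ : CharZero O) (_ : IsAdicComplete (IsLocalRing.maximalIdeal O) O) (_ : IsAlgClosed (IsLocalRing.ResidueField O)) (P : AlgebraicGeometry.Scheme.{0}) (q : P ⟶ AlgebraicGeometry.Spec (.of O)) (Y : TopologicalSpace.Closeds P),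 AlgebraicGeometry.Smooth q ∧ AlgebraicGeometry.IsProper q ∧ (Y : Set P) ⊆ q ⁻¹' {IsLocalRing.closedPoint O} ∧ Nonempty ((AlgebraicGeometry.Scheme.IdealSheafData.vanishingIdeal Y).subscheme ≅ H) ∧ IsIrreducible (q ⁻¹' {IsLocalRing.closedPoint O})) →
    (∀ p : ℕ, p.Prime → ∀ (k : Type) [Field k] [CharP k p] [IsAlgClosed k] (n : ℕ) (H : AlgebraicGeometry.Scheme.{0}) (ι : H ⟶ (Literature.AlgebraicGeometry.Motives.projectiveSpace n k).left), AlgebraicGeometry.IsClosedImmersion ι → AlgebraicGeometry.IsIntegral H → (∀ y : (Literature.AlgebraicGeometry.Motives.projectiveSpace n k).left, ∃ U : (Literature.AlgebraicGeometry.Motives.projectiveSpace n k).left.affineOpens, y ∈ (U : (Literature.AlgebraicGeometry.Motives.projectiveSpace n k).left.Opens) ∧ (ι.ker.ideal U).IsPrincipal) → ∀ (O : Type) [CommRing O] [IsDomain O] [IsDiscreteValuationRing O] [CharZero O] [IsAdicComplete (IsLocalRing.maximalIdeal O) O] [IsAlgClosed (IsLocalRing.ResidueField O)] (P : AlgebraicGeometry.Scheme.{0})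 (q : P ⟶ AlgebraicGeometry.Spec (.of O)) (Y : TopologicalSpace.Closeds P), AlgebraicGeometry.Smooth q → AlgebraicGeometry.IsProper q → (Y : Set P) ⊆ q ⁻¹' {IsLocalRing.closedPoint O} → Nonempty ((AlgebraicGeometry.Scheme.IdealSheafData.vanishingIdeal Y).subscheme ≅ H) → IsIrreducible (q ⁻¹' {IsLocalRing.closedPoint O}) → ∃ (P' : AlgebraicGeometry.Scheme.{0}) (σ : P' ⟶ P) (S' : Set P'), Chain P (Y : Set P) P' σ S' ∧ IsIrreducible (((CategoryTheory.CategoryStruct.comp σ q)) ⁻¹' {IsLocalRing.closedPoint O}) ∧ (singSet S').Finite ∧ GoodSet ((CategoryTheory.CategoryStruct.comp σ q)) S') →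
    LiftableIsolation := by
  intro h1 h2 p hp k _ _ _ n H ι hι hH hpr
  obtain ⟨O, i1, i2, i3, i4, i5, i6, P, q, Y, hq, hqp, hY, ⟨e⟩, hirr⟩ := h1 p hp k n H ι hι hH hpr
  obtain ⟨P', σ, S', hch, hirr', hfin, hgood⟩ := h2 p hp k n H ι hι hH hpr O P q Y hq hqp hY ⟨e⟩ hirr
  refine ⟨O, i1, i2, i3, i4, i5, i6, P, P', q, Y, σ, S', hq, hqp, hY, ⟨e⟩, ?_, hirr', hfin, ?_⟩
  · exact hch
  · exact hgood

/-- The child, assembled from the two registered stubs (only `sorry`s in its closure: the two stubs). -/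
theorem LiftableIsolation_proof : LiftableIsolation :=
  LiftableIsolation_of stub_ambientLift stub_isolateInAmbient

end Summit.ResolutionOfSingularities.ResolutionOfSingularities.Cruxes.LiftableIsolation.Birth

end
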